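import Summits.QuantumFields.YangMills.Theorems.UnitScaleTiltProp7NestedMeanParallelLiftInhabited
import Summits.QuantumFields.YangMills.Theorems.UnitScaleTiltProp8ChartCovariance
import Summits.QuantumFields.YangMills.Theorems.UnitScaleTiltHalvingCompetitorMapFibre
import Summits.QuantumFields.YangMills.Theorems.UnitScaleTiltProp7SymAvgGLSmallOfRegPr
import Literature.MathematicalPhysics.QuantumFieldTheory.Balaban1983to89.T3PrintedRegularOrbits
import Literature.MathematicalPhysics.QuantumFieldTheory.Balaban1983to89.T3SectALandauChart
import Literature.MathematicalPhysics.QuantumFieldTheory.Balaban1983to89.T3DescentFibreTower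
import HarnessLib

/-!
# Route `UnitScaleTilt`, crux K1 child «MinimiserStabilityRegPr» (stmt-QuantumFields-19200), stub `stub_existenceMinimalOrbit` (EX), line «SYM-CENTRE»
# (★★OWNER RULING g28-№7, cure (ii-a) of located defect №7) — **THE LIFTING RESIDUE `hLift` IS A GAUGE-ORBIT PROPERTY, AND THE TARGET ROW
# `hSymCentre` IS INHABITED BY KERNEL ON THE PURE-GAUGE STRATUM (incl. the main case `V = 1`) AND AT EVERY CENTRE OVER AN IRREDUCIBLE `V`**

Cell `ym3-torus`, width seat `ym3-torus-px6` (gen 3).  THEOREMS ONLY (0 `def`, 0 `sorry`).  `--supports stmt-QuantumFields-19200 --as helper`, count-neutral.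
YM₃ on T³ is a ladder rung (R3), not the Clay problem; nothing here claims the stub, the crux, d = 4 or the mass gap.

THE POINT.  The (P2-core) residue `hLift U₀` («every `Ū₀`-parallel coarse section lifts to a `U₀`-parallel fine section», ✓`hHZ_of_parallelLift`'s binder,
✓p671435 `hSplitD_of_Y1`'s antecedent of record) FAILS at the given centre `U₀` near symmetric strata (19200 evidence #49∕#51) and the cure of record
(RULING g28-№7) re-centres the EX knit at a point `U₀*` supplied by ONE new displayed ∃-row
`hSymCentre : ∀ V, PlaqSmall ε₁ V → ∃ U₀*, U₀* ∈ fibre V ∧ RegPr (L³·3L·ε₁) U₀* ∧ CloseAvg (L³ε₁) V U₀* ∧ hLift U₀*`.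
This file records, by kernel and with NO window, what the averaging's GAUGE COVARIANCE already gives towards that row:
* §1 (generic `𝔸ˣ`-valued fields, `Prop8Chart` letters) ★★`parallelLift_gaugeActT` — the lifting property is transported along gauge orbits: if it holds for `W`
  it holds for `W^u` (✓`emlIterU_gaugeActT` with the tower `u ∘ embIter j`; sections conjugate by `u`, resp. `u ∘ embIter k`); `parallelLift_one` (at `W = 1`
  parallel = shift-invariant = constant, ✓`const_of_shift_eq`); `parallelLift_pureGauge`.
* §2 (T³ member, `SU(2)`) ★★`hLift_gaugeAct`∕`hLift_gaugeAct_iff` — `hLift (u • U₀) ↔ hLift U₀` (✓`unitsField_toUField_gaugeAct`): the residue depends on the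
  GAUGE ORBIT of the centre only (consistent with #51's reading `hLift(U₀) ⟺ s(U₀) = p`); ★`hLift_of_pureGauge` — `hLift (u • 1)` (⊇ ✓`hLift_of_flat`).
* §3 ★★★`hSymCentre_of_pureGauge` — over every PURE-GAUGE coarse field `V = w • 1` (this contains the main case `V = 1` of #49) and for ALL radii `a, b > 0`
  the block-constant gauge lift of the trivial field, `U₀* := (liftTransfTo w) • 1`, satisfies the four conjuncts of `hSymCentre`
  (✓`gaugeAct_mem_fibre_iff` ∘ ✓`descTransf_liftTransfTo` ∘ ✓`one_mem_fibre_one`; ✓`regPr_gaugeAct_iff` ∘ ✓`regPr_one`; ✓`closeAvg_of_mem_fibre`; §2);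
  `exists_symCentre_of_pureGauge` (the ∃-form); ★`symCentre_gaugeAct` (the four conjuncts are transported along orbits: a centre for `V` gives one for
  `(u↓) • V`).
* §4 ★★`hLift_of_mem_fibre_of_irreducible` — over a coarse field `V` whose only `V♭`-parallel sections are the scalars («`V` irreducible», the generic
  case) EVERY regular fibre point serves as centre: `U₀ ∈ fibre V → RegPr ε₀ U₀ → hLift U₀` (`10⁷L³ε₀ ≤ 1`; ✓`hLift_of_onlyScalarParallel` through the
  descent∕`emlIterU` bridge ✓`descendTo_eq_fieldShift_emlIterU_of_regPr`), hence `hSymCentre_of_irreducible` from any regular fibre point.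
WHAT THIS LEAVES FOR THE LINE «SYM-CENTRE» (commentary for the LOCATE, not a claim of this file): by the `SU(2)` commutant trichotomy the strata NOT
covered here are (α) `V` with holonomy in a maximal torus but not central (abelian, reducible) and (β) flat `V` with a non-trivial `Z₂` cycle sign.
HONEST SCOPE.  Bookkeeping∕covariance only; no estimate; no stub ∕ crux statement is advanced; `hSymCentre` in general stays the line's displayed row.

References: T. Bałaban, CMP 98 (1985) 17–51 [Balaban1985Averaging] ((8)–(13) p.19, (97) p.32); CMP 102 (1985) 277–309 [Balaban1985Variational]
((2)–(6) p.278, (13)–(14) p.280); CMP 99 (1985) 389–434 [Balaban1985BackgroundPropagators] ((3.19)–(3.21) pp.393–394); CMP 109 (1987) 249–301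
[Balaban1987RG1] ((0.4), (0.11) p.253).
-/

set_option autoImplicit false

noncomputable section

open scoped BigOperators Matrix.Norms.L2Operator

namespace Summit.QuantumFields.YangMills.Theorems.Prop7NestedMeanParallelLift

open Literature.MathematicalPhysics.QuantumFieldTheory.Balaban1983to89
open T4Continuum BlockAveraging
open B10Eq27TorusAxialLog (gaugeActT gaugeActT_apply unitsField toUField)
open B15DeterminingSets (embIter)
open Summit.QuantumFields.YangMills.Theorems.Prop8Chart (emlIterU emlIterU_one emlIterU_gaugeActT)
open Summit.QuantumFields.YangMills.BalabanUVNodes.N12FlatFibreNullSpace (const_of_shift_eq)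
open B5Positivity172Lattice (TT ofT)

/-! ## §1 Generic: the lifting property along gauge orbits of `𝔸ˣ`-valued fields -/

section Generic

variable {P : Params} {𝔸 : Type*} [NormedRing 𝔸] [NormedAlgebra ℂ 𝔸] [CompleteSpace 𝔸]

/-- ★★ **THE LIFTING PROPERTY IS TRANSPORTED ALONG GAUGE ORBITS.**  If every `Ū⁽ᵏ⁾(W)`-parallel coarse section lifts to a `W`-parallel fine section
(agreeing with it on the `k`-fold block centres), then the same holds for the gauge copy `W^u`, `u : T⁽⁰⁾ → 𝔸ˣ` arbitrary: `Ū⁽ᵏ⁾(W^u) = (Ū⁽ᵏ⁾W)^{u∘embIter k}`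
(✓`emlIterU_gaugeActT`), so a coarse section `c` parallel for `Ū⁽ᵏ⁾(W^u)` is the `u∘embIter k`-conjugate of one parallel for `Ū⁽ᵏ⁾(W)`, whose lift
conjugated back by `u` is `W^u`-parallel. [cite: Balaban1985Averaging, (8)-(11) p.19; Balaban1985BackgroundPropagators, (3.21) p.394] -/
theorem parallelLift_gaugeActT (k : ℕ) (u : GaugeTransf P 0 𝔸ˣ) (W : GaugeField P 0 𝔸ˣ)
    (hW : ∀ cf : Site P k → 𝔸,
      (∀ e : PBond P k, cf e.src = ((emlIterU k W e : 𝔸ˣ) : 𝔸) * cf e.tgt * (((emlIterU k W e)⁻¹ : 𝔸ˣ) : 𝔸)) →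
      ∃ l₀ : Site P 0 → 𝔸, (∀ b : PBond P 0, l₀ b.src = ((W b : 𝔸ˣ) : 𝔸) * l₀ b.tgt * (((W b)⁻¹ : 𝔸ˣ) : 𝔸)) ∧
        ∀ y : Site P k, l₀ (embIter k y) = cf y) :
    ∀ cf : Site P k → 𝔸,
      (∀ e : PBond P k, cf e.src = ((emlIterU k (gaugeActT u W) e : 𝔸ˣ) : 𝔸) * cf e.tgt * (((emlIterU k (gaugeActT u W) e)⁻¹ : 𝔸ˣ) : 𝔸)) →
      ∃ l₀ : Site P 0 → 𝔸, (∀ b : PBond P 0, l₀ b.src = ((gaugeActT u W b : 𝔸ˣ) : 𝔸) * l₀ b.tgt * (((gaugeActT u W b)⁻¹ : 𝔸ˣ) : 𝔸)) ∧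
        ∀ y : Site P k, l₀ (embIter k y) = cf y := by
  intro cf hpar
  -- covariance of the iterated average along the tower `u ∘ embIter j`
  have hiter : emlIterU k (gaugeActT u W) = gaugeActT (fun y : Site P k => u (embIter k y)) (emlIterU k W) :=
    emlIterU_gaugeActT (fun i => fun y : Site P i => u (embIter i y)) (fun _ _ => rfl) W k
  -- the conjugated coarse section is parallel for `Ū⁽ᵏ⁾(W)`
  have hpar₀ : ∀ e : PBond P k,
      (fun y => (((u (embIter k y))⁻¹ : 𝔸ˣ) : 𝔸) * cf y * ((u (embIter k y) : 𝔸ˣ) : 𝔸)) e.src =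
        ((emlIterU k W e : 𝔸ˣ) : 𝔸) * (fun y => (((u (embIter k y))⁻¹ : 𝔸ˣ) : 𝔸) * cf y * ((u (embIter k y) : 𝔸ˣ) : 𝔸)) e.tgt *
          (((emlIterU k W e)⁻¹ : 𝔸ˣ) : 𝔸) := by
    intro e
    have h := hpar e
    rw [hiter, gaugeActT_apply] at h
    simp only
    rw [h]
    simp only [mul_inv_rev, inv_inv, Units.val_mul, mul_assoc, Units.inv_mul_cancel_left, Units.inv_mul, mul_one]
  obtain ⟨l₀, hl₀, htop⟩ :=
    hW (fun y => (((u (embIter k y))⁻¹ : 𝔸ˣ) : 𝔸) * cf y * ((u (embIter k y) : 𝔸ˣ) : 𝔸)) hpar₀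
  refine ⟨fun x => ((u x : 𝔸ˣ) : 𝔸) * l₀ x * (((u x)⁻¹ : 𝔸ˣ) : 𝔸), fun b => ?_, fun y => ?_⟩
  · show ((u b.src : 𝔸ˣ) : 𝔸) * l₀ b.src * (((u b.src)⁻¹ : 𝔸ˣ) : 𝔸) =
      ((gaugeActT u W b : 𝔸ˣ) : 𝔸) * (((u b.tgt : 𝔸ˣ) : 𝔸) * l₀ b.tgt * (((u b.tgt)⁻¹ : 𝔸ˣ) : 𝔸)) * (((gaugeActT u W b)⁻¹ : 𝔸ˣ) : 𝔸)
    rw [hl₀ b, gaugeActT_apply]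
    simp only [mul_inv_rev, inv_inv, Units.val_mul, mul_assoc, Units.inv_mul_cancel_left]
  · show ((u (embIter k y) : 𝔸ˣ) : 𝔸) * l₀ (embIter k y) * (((u (embIter k y))⁻¹ : 𝔸ˣ) : 𝔸) = cf y
    simp only [htop y, mul_assoc, Units.mul_inv_cancel_left, Units.mul_inv, mul_one]

/-- **AT THE TRIVIAL FIELD EVERY PARALLEL COARSE SECTION LIFTS**: `Ū⁽ᵏ⁾(1) = 1` (✓`emlIterU_one`), parallel for `1` means shift-invariant, hence constant on
the connected coarse torus (✓`const_of_shift_eq`), and the constant fine section lifts it. [cite: Balaban1984PropagatorsII, (2.7)-(2.12) pp.224-225] -/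
theorem parallelLift_one (k : ℕ) :
    ∀ cf : Site P k → 𝔸,
      (∀ e : PBond P k, cf e.src = ((emlIterU k (fun _ : PBond P 0 => (1 : 𝔸ˣ)) e : 𝔸ˣ) : 𝔸) * cf e.tgt *
        (((emlIterU k (fun _ : PBond P 0 => (1 : 𝔸ˣ)) e)⁻¹ : 𝔸ˣ) : 𝔸)) →
      ∃ l₀ : Site P 0 → 𝔸, (∀ b : PBond P 0, l₀ b.src = (((fun _ : PBond P 0 => (1 : 𝔸ˣ)) b : 𝔸ˣ) : 𝔸) * l₀ b.tgt *
          ((((fun _ : PBond P 0 => (1 : 𝔸ˣ)) b)⁻¹ : 𝔸ˣ) : 𝔸)) ∧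
        ∀ y : Site P k, l₀ (embIter k y) = cf y := by
  intro cf hpar
  have hshift : ∀ (y : Site P k) (μ : Fin P.d), cf (y.shift μ) = cf y := by
    intro y μ
    have h := hpar ⟨y, μ⟩
    rw [emlIterU_one] at h
    simp only [inv_one, Units.val_one, one_mul, mul_one] at h
    exact h.symm
  refine ⟨fun _ => cf (ofT (0 : TT P k)), fun b => ?_, fun y => (const_of_shift_eq cf hshift y).symm⟩
  simp only [inv_one, Units.val_one, one_mul, mul_one]

/-- **EVERY PURE GAUGE HAS THE LIFTING PROPERTY** (`parallelLift_gaugeActT` ∘ `parallelLift_one`). [cite: Balaban1985Averaging, (11) p.19] -/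
theorem parallelLift_pureGauge (k : ℕ) (u : GaugeTransf P 0 𝔸ˣ) :
    ∀ cf : Site P k → 𝔸,
      (∀ e : PBond P k, cf e.src = ((emlIterU k (gaugeActT u fun _ : PBond P 0 => (1 : 𝔸ˣ)) e : 𝔸ˣ) : 𝔸) * cf e.tgt *
        (((emlIterU k (gaugeActT u fun _ : PBond P 0 => (1 : 𝔸ˣ)) e)⁻¹ : 𝔸ˣ) : 𝔸)) →
      ∃ l₀ : Site P 0 → 𝔸, (∀ b : PBond P 0, l₀ b.src = ((gaugeActT u (fun _ : PBond P 0 => (1 : 𝔸ˣ)) b : 𝔸ˣ) : 𝔸) * l₀ b.tgt *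
          (((gaugeActT u (fun _ : PBond P 0 => (1 : 𝔸ˣ)) b)⁻¹ : 𝔸ˣ) : 𝔸)) ∧
        ∀ y : Site P k, l₀ (embIter k y) = cf y :=
  parallelLift_gaugeActT k u _ (parallelLift_one k)

end Generic

/-! ## §2 T³ member: `hLift` is a gauge-orbit property; pure gauges -/

section T3

open Literature.MathematicalPhysics.QuantumFieldTheory.Balaban1983to89.T3ContinuumYM3Torus
open T3UnitLawDensityEML (ℰp)
open T3TiltDescent (descendTo)
open T3ConstrainedMinimiser (fibre)
open T3DescentFibreTower (one_mem_fibre_one expMeanLogSU_E_one)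
open T3PrintedRegularMinimiser (RegPr regPr_one)
open T3PrintedRegularOrbits (descTransf liftTransfTo descTransf_liftTransfTo gaugeAct_mem_fibre_iff regPr_gaugeAct_iff)
open T3SectALandauChart (bgUnits CloseAvg closeAvg_of_mem_fibre bgUnits_one)
open T3UnitLawGaugeInvariance (gaugeAct_gaugeAct)
open T3LevelShift (siteShift bondShift fieldShift fieldShift_apply bondShift_src bondShift_tgt)
open HalvingCompetitorMapFibre (unitsField_toUField_gaugeAct)
open Prop7SymAvgGLSmallOfRegPr (descendTo_eq_fieldShift_emlIterU_of_regPr)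

variable (F : T3Family) {n K : ℕ}

/-- the units reading of a gauge copy of the background: `(u • U₀)♭ = (U₀♭)^{û}`, `û x = toUnits (suIncl (u x))` (✓`unitsField_toUField_gaugeAct` in the
`bgUnits` letter). [cite: Balaban1985Averaging, (8) p.19] -/
theorem bgUnits_gaugeAct (u : GaugeTransf (F.P K) 0 (Matrix.specialUnitaryGroup (Fin 2) ℂ))
    (U₀ : GaugeField (F.P K) 0 (Matrix.specialUnitaryGroup (Fin 2) ℂ)) :
    bgUnits F K (GaugeField.gaugeAct u U₀) = gaugeActT (fun x => Unitary.toUnits (B10Eq27TorusAxialLog.suIncl (u x))) (bgUnits F K U₀) :=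
  unitsField_toUField_gaugeAct u U₀

/-- ★★ **`hLift` IS TRANSPORTED ALONG `SU(2)` GAUGE ORBITS**: `hLift U₀ → hLift (u • U₀)` (§1 at `W := U₀♭`, `k := K − n`).
[cite: Balaban1985Averaging, (8)-(11) p.19; Balaban1985BackgroundPropagators, (3.21) p.394] -/
theorem hLift_gaugeAct (u : GaugeTransf (F.P K) 0 (Matrix.specialUnitaryGroup (Fin 2) ℂ))
    (U₀ : GaugeField (F.P K) 0 (Matrix.specialUnitaryGroup (Fin 2) ℂ))
    (hLift : ∀ cf : Site (F.P K) (K - n) → Matrix (Fin 2) (Fin 2) ℂ,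
      (∀ e : PBond (F.P K) (K - n), cf e.src = ((emlIterU (K - n) (bgUnits F K U₀) e : (Matrix (Fin 2) (Fin 2) ℂ)ˣ) : Matrix (Fin 2) (Fin 2) ℂ) * cf e.tgt *
        (((emlIterU (K - n) (bgUnits F K U₀) e)⁻¹ : (Matrix (Fin 2) (Fin 2) ℂ)ˣ) : Matrix (Fin 2) (Fin 2) ℂ)) →
      ∃ l₀ : Site (F.P K) 0 → Matrix (Fin 2) (Fin 2) ℂ,
        (∀ b : PBond (F.P K) 0, l₀ b.src = ((bgUnits F K U₀ b : (Matrix (Fin 2) (Fin 2) ℂ)ˣ) : Matrix (Fin 2) (Fin 2) ℂ) * l₀ b.tgt * (((bgUnits F K U₀ b)⁻¹ : (Matrix (Fin 2) (Fin 2) ℂ)ˣ) : Matrix (Fin 2) (Fin 2) ℂ)) ∧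
        ∀ y : Site (F.P K) (K - n), l₀ (embIter (K - n) y) = cf y) :
    ∀ cf : Site (F.P K) (K - n) → Matrix (Fin 2) (Fin 2) ℂ,
      (∀ e : PBond (F.P K) (K - n), cf e.src = ((emlIterU (K - n) (bgUnits F K (GaugeField.gaugeAct u U₀)) e : (Matrix (Fin 2) (Fin 2) ℂ)ˣ) : Matrix (Fin 2) (Fin 2) ℂ) * cf e.tgt *
        (((emlIterU (K - n) (bgUnits F K (GaugeField.gaugeAct u U₀)) e)⁻¹ : (Matrix (Fin 2) (Fin 2) ℂ)ˣ) : Matrix (Fin 2) (Fin 2) ℂ)) →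
      ∃ l₀ : Site (F.P K) 0 → Matrix (Fin 2) (Fin 2) ℂ,
        (∀ b : PBond (F.P K) 0, l₀ b.src = ((bgUnits F K (GaugeField.gaugeAct u U₀) b : (Matrix (Fin 2) (Fin 2) ℂ)ˣ) : Matrix (Fin 2) (Fin 2) ℂ) * l₀ b.tgt *
          (((bgUnits F K (GaugeField.gaugeAct u U₀) b)⁻¹ : (Matrix (Fin 2) (Fin 2) ℂ)ˣ) : Matrix (Fin 2) (Fin 2) ℂ)) ∧
        ∀ y : Site (F.P K) (K - n), l₀ (embIter (K - n) y) = cf y := by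
  rw [bgUnits_gaugeAct]
  exact parallelLift_gaugeActT (K - n) _ (bgUnits F K U₀) hLift

/-- The inverse gauge transformation undoes the action. [cite: Balaban1985Averaging, (8) p.19] -/
theorem gaugeAct_inv_gaugeAct (u : GaugeTransf (F.P K) 0 (Matrix.specialUnitaryGroup (Fin 2) ℂ))
    (U₀ : GaugeField (F.P K) 0 (Matrix.specialUnitaryGroup (Fin 2) ℂ)) :
    GaugeField.gaugeAct (fun x => (u x)⁻¹) (GaugeField.gaugeAct u U₀) = U₀ := by
  rw [gaugeAct_gaugeAct]
  funext b
  simp [GaugeField.gaugeAct]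

/-- ★★ **`hLift` IS A GAUGE-ORBIT PROPERTY**: `hLift (u • U₀) ↔ hLift U₀` — the residue of the (P2-core) knit depends only on the gauge orbit of the chart
centre (cf. evidence #51: `hLift(U₀) ⟺ s(U₀) = p`, a stabiliser statement). [cite: Balaban1985Averaging, (8)-(11) p.19; Balaban1985Variational, (3)-(4) p.278] -/
theorem hLift_gaugeAct_iff (u : GaugeTransf (F.P K) 0 (Matrix.specialUnitaryGroup (Fin 2) ℂ))
    (U₀ : GaugeField (F.P K) 0 (Matrix.specialUnitaryGroup (Fin 2) ℂ)) :
    (∀ cf : Site (F.P K) (K - n) → Matrix (Fin 2) (Fin 2) ℂ,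
      (∀ e : PBond (F.P K) (K - n), cf e.src = ((emlIterU (K - n) (bgUnits F K (GaugeField.gaugeAct u U₀)) e : (Matrix (Fin 2) (Fin 2) ℂ)ˣ) : Matrix (Fin 2) (Fin 2) ℂ) * cf e.tgt *
        (((emlIterU (K - n) (bgUnits F K (GaugeField.gaugeAct u U₀)) e)⁻¹ : (Matrix (Fin 2) (Fin 2) ℂ)ˣ) : Matrix (Fin 2) (Fin 2) ℂ)) →
      ∃ l₀ : Site (F.P K) 0 → Matrix (Fin 2) (Fin 2) ℂ,
        (∀ b : PBond (F.P K) 0, l₀ b.src = ((bgUnits F K (GaugeField.gaugeAct u U₀) b : (Matrix (Fin 2) (Fin 2) ℂ)ˣ) : Matrix (Fin 2) (Fin 2) ℂ) * l₀ b.tgt *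
          (((bgUnits F K (GaugeField.gaugeAct u U₀) b)⁻¹ : (Matrix (Fin 2) (Fin 2) ℂ)ˣ) : Matrix (Fin 2) (Fin 2) ℂ)) ∧
        ∀ y : Site (F.P K) (K - n), l₀ (embIter (K - n) y) = cf y) ↔
    (∀ cf : Site (F.P K) (K - n) → Matrix (Fin 2) (Fin 2) ℂ,
      (∀ e : PBond (F.P K) (K - n), cf e.src = ((emlIterU (K - n) (bgUnits F K U₀) e : (Matrix (Fin 2) (Fin 2) ℂ)ˣ) : Matrix (Fin 2) (Fin 2) ℂ) * cf e.tgt *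
        (((emlIterU (K - n) (bgUnits F K U₀) e)⁻¹ : (Matrix (Fin 2) (Fin 2) ℂ)ˣ) : Matrix (Fin 2) (Fin 2) ℂ)) →
      ∃ l₀ : Site (F.P K) 0 → Matrix (Fin 2) (Fin 2) ℂ,
        (∀ b : PBond (F.P K) 0, l₀ b.src = ((bgUnits F K U₀ b : (Matrix (Fin 2) (Fin 2) ℂ)ˣ) : Matrix (Fin 2) (Fin 2) ℂ) * l₀ b.tgt * (((bgUnits F K U₀ b)⁻¹ : (Matrix (Fin 2) (Fin 2) ℂ)ˣ) : Matrix (Fin 2) (Fin 2) ℂ)) ∧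
        ∀ y : Site (F.P K) (K - n), l₀ (embIter (K - n) y) = cf y) := by
  refine ⟨fun h => ?_, hLift_gaugeAct F u U₀⟩
  have h' := hLift_gaugeAct F (n := n) (fun x => (u x)⁻¹) (GaugeField.gaugeAct u U₀) h
  rwa [gaugeAct_inv_gaugeAct] at h'

/-- ★ **`hLift` AT EVERY PURE GAUGE** `u • 1` (⊇ ✓`hLift_of_flat`: `bgUnits 1 = 1`, then §2's transport). [cite: Balaban1985Averaging, (11) p.19] -/
theorem hLift_of_pureGauge (u : GaugeTransf (F.P K) 0 (Matrix.specialUnitaryGroup (Fin 2) ℂ)) :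
    ∀ cf : Site (F.P K) (K - n) → Matrix (Fin 2) (Fin 2) ℂ,
      (∀ e : PBond (F.P K) (K - n), cf e.src =
          ((emlIterU (K - n) (bgUnits F K (GaugeField.gaugeAct u (1 : GaugeField (F.P K) 0 (Matrix.specialUnitaryGroup (Fin 2) ℂ)))) e : (Matrix (Fin 2) (Fin 2) ℂ)ˣ) : Matrix (Fin 2) (Fin 2) ℂ) * cf e.tgt *
        (((emlIterU (K - n) (bgUnits F K (GaugeField.gaugeAct u (1 : GaugeField (F.P K) 0 (Matrix.specialUnitaryGroup (Fin 2) ℂ)))) e)⁻¹ : (Matrix (Fin 2) (Fin 2) ℂ)ˣ) : Matrix (Fin 2) (Fin 2) ℂ)) →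
      ∃ l₀ : Site (F.P K) 0 → Matrix (Fin 2) (Fin 2) ℂ,
        (∀ b : PBond (F.P K) 0, l₀ b.src = ((bgUnits F K (GaugeField.gaugeAct u (1 : GaugeField (F.P K) 0 (Matrix.specialUnitaryGroup (Fin 2) ℂ))) b : (Matrix (Fin 2) (Fin 2) ℂ)ˣ) : Matrix (Fin 2) (Fin 2) ℂ) * l₀ b.tgt *
          (((bgUnits F K (GaugeField.gaugeAct u (1 : GaugeField (F.P K) 0 (Matrix.specialUnitaryGroup (Fin 2) ℂ))) b)⁻¹ : (Matrix (Fin 2) (Fin 2) ℂ)ˣ) : Matrix (Fin 2) (Fin 2) ℂ)) ∧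
        ∀ y : Site (F.P K) (K - n), l₀ (embIter (K - n) y) = cf y :=
  hLift_gaugeAct F u 1 (hLift_of_flat F 1 bgUnits_one)

/-! ## §3 `hSymCentre` on the pure-gauge stratum, by kernel -/

/-- ★★★ **THE SYMMETRIC REGULAR CENTRE OVER A PURE-GAUGE COARSE FIELD.**  For `V = w • 1` on the comparison lattice `T_{(n)}` (in particular `V = 1`) and
all radii `a, b > 0`, the gauge lift of the trivial field `U₀* := (liftTransfTo w) • 1` lies in the fibre of `V` (covariance of the descent ✓`descendTo_gaugeAct`
with `(liftTransfTo w)↓ = w`, and `D_{n,K} 1 = 1`), is printed-regular of radius `a` (the regular space is gauge invariant and contains `1`), has its averages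
`b`-close to `V` (it is IN the fibre), and satisfies the lifting residue `hLift` (§2) — i.e. the four conjuncts of the line's displayed row `hSymCentre`, with
NO window. [cite: Balaban1985Variational, (2)-(6) p.278, (13)-(14) p.280; Balaban1985Averaging, (11)-(13) p.19] -/
theorem hSymCentre_of_pureGauge (h : n ≤ K) (w : GaugeTransf (F.P n) 0 (Matrix.specialUnitaryGroup (Fin 2) ℂ)) {a b : ℝ} (ha : 0 < a) (hb : 0 < b) :
    GaugeField.gaugeAct (liftTransfTo F n K h w) (1 : GaugeField (F.P K) 0 (Matrix.specialUnitaryGroup (Fin 2) ℂ)) ∈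
        fibre F ℰp n K h (GaugeField.gaugeAct w (1 : GaugeField (F.P n) 0 (Matrix.specialUnitaryGroup (Fin 2) ℂ))) ∧
      RegPr F n K a (GaugeField.gaugeAct (liftTransfTo F n K h w) (1 : GaugeField (F.P K) 0 (Matrix.specialUnitaryGroup (Fin 2) ℂ))) ∧
      CloseAvg F n K h b (GaugeField.gaugeAct w (1 : GaugeField (F.P n) 0 (Matrix.specialUnitaryGroup (Fin 2) ℂ)))
        (GaugeField.gaugeAct (liftTransfTo F n K h w) (1 : GaugeField (F.P K) 0 (Matrix.specialUnitaryGroup (Fin 2) ℂ))) ∧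
      ∀ cf : Site (F.P K) (K - n) → Matrix (Fin 2) (Fin 2) ℂ,
        (∀ e : PBond (F.P K) (K - n), cf e.src =
            ((emlIterU (K - n) (bgUnits F K (GaugeField.gaugeAct (liftTransfTo F n K h w) (1 : GaugeField (F.P K) 0 (Matrix.specialUnitaryGroup (Fin 2) ℂ)))) e : (Matrix (Fin 2) (Fin 2) ℂ)ˣ) : Matrix (Fin 2) (Fin 2) ℂ) * cf e.tgt *
          (((emlIterU (K - n) (bgUnits F K (GaugeField.gaugeAct (liftTransfTo F n K h w) (1 : GaugeField (F.P K) 0 (Matrix.specialUnitaryGroup (Fin 2) ℂ)))) e)⁻¹ : (Matrix (Fin 2) (Fin 2) ℂ)ˣ) : Matrix (Fin 2) (Fin 2) ℂ)) →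
        ∃ l₀ : Site (F.P K) 0 → Matrix (Fin 2) (Fin 2) ℂ,
          (∀ b' : PBond (F.P K) 0, l₀ b'.src = ((bgUnits F K (GaugeField.gaugeAct (liftTransfTo F n K h w) (1 : GaugeField (F.P K) 0 (Matrix.specialUnitaryGroup (Fin 2) ℂ))) b' : (Matrix (Fin 2) (Fin 2) ℂ)ˣ) : Matrix (Fin 2) (Fin 2) ℂ) * l₀ b'.tgt *
            (((bgUnits F K (GaugeField.gaugeAct (liftTransfTo F n K h w) (1 : GaugeField (F.P K) 0 (Matrix.specialUnitaryGroup (Fin 2) ℂ))) b')⁻¹ : (Matrix (Fin 2) (Fin 2) ℂ)ˣ) : Matrix (Fin 2) (Fin 2) ℂ)) ∧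
          ∀ y : Site (F.P K) (K - n), l₀ (embIter (K - n) y) = cf y := by
  have hfib : GaugeField.gaugeAct (liftTransfTo F n K h w) (1 : GaugeField (F.P K) 0 (Matrix.specialUnitaryGroup (Fin 2) ℂ)) ∈
      fibre F ℰp n K h (GaugeField.gaugeAct w (1 : GaugeField (F.P n) 0 (Matrix.specialUnitaryGroup (Fin 2) ℂ))) := by
    have h1 := (gaugeAct_mem_fibre_iff F h ℰp (liftTransfTo F n K h w) (1 : GaugeField (F.P K) 0 (Matrix.specialUnitaryGroup (Fin 2) ℂ))
      (1 : GaugeField (F.P n) 0 (Matrix.specialUnitaryGroup (Fin 2) ℂ))).2 (one_mem_fibre_one F ℰp expMeanLogSU_E_one h)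
    rwa [descTransf_liftTransfTo] at h1
  exact ⟨hfib, (regPr_gaugeAct_iff F ha.le _ _).2 (regPr_one ha), closeAvg_of_mem_fibre hb hfib, hLift_of_pureGauge F _⟩

/-- **THE ∃-FORM**: over a pure-gauge `V` the row `hSymCentre` is inhabited for all radii `a, b > 0`. [cite: Balaban1985Variational, (2)-(6) p.278, (13)-(14) p.280] -/
theorem exists_symCentre_of_pureGauge (h : n ≤ K) {V : GaugeField (F.P n) 0 (Matrix.specialUnitaryGroup (Fin 2) ℂ)}
    (hV : ∃ w : GaugeTransf (F.P n) 0 (Matrix.specialUnitaryGroup (Fin 2) ℂ), V = GaugeField.gaugeAct w 1) {a b : ℝ} (ha : 0 < a) (hb : 0 < b) :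
    ∃ U₀ : GaugeField (F.P K) 0 (Matrix.specialUnitaryGroup (Fin 2) ℂ),
      U₀ ∈ fibre F ℰp n K h V ∧ RegPr F n K a U₀ ∧ CloseAvg F n K h b V U₀ ∧
      ∀ cf : Site (F.P K) (K - n) → Matrix (Fin 2) (Fin 2) ℂ,
        (∀ e : PBond (F.P K) (K - n), cf e.src = ((emlIterU (K - n) (bgUnits F K U₀) e : (Matrix (Fin 2) (Fin 2) ℂ)ˣ) : Matrix (Fin 2) (Fin 2) ℂ) * cf e.tgt *
          (((emlIterU (K - n) (bgUnits F K U₀) e)⁻¹ : (Matrix (Fin 2) (Fin 2) ℂ)ˣ) : Matrix (Fin 2) (Fin 2) ℂ)) →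
        ∃ l₀ : Site (F.P K) 0 → Matrix (Fin 2) (Fin 2) ℂ,
          (∀ b' : PBond (F.P K) 0, l₀ b'.src = ((bgUnits F K U₀ b' : (Matrix (Fin 2) (Fin 2) ℂ)ˣ) : Matrix (Fin 2) (Fin 2) ℂ) * l₀ b'.tgt * (((bgUnits F K U₀ b')⁻¹ : (Matrix (Fin 2) (Fin 2) ℂ)ˣ) : Matrix (Fin 2) (Fin 2) ℂ)) ∧
          ∀ y : Site (F.P K) (K - n), l₀ (embIter (K - n) y) = cf y := by
  obtain ⟨w, rfl⟩ := hV
  exact ⟨_, hSymCentre_of_pureGauge F h w ha hb⟩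

/-- ★ **SYMMETRIC CENTRES ARE TRANSPORTED ALONG ORBITS**: if `U₀*` serves `V` (fibre, `RegPr a`, `CloseAvg b`, `hLift`), then `u • U₀*` serves `(u↓) • V`
(`a ≥ 0 < b`; ✓`gaugeAct_mem_fibre_iff`, ✓`regPr_gaugeAct_iff`, ✓`closeAvg_of_mem_fibre`, §2) — the equivariance letter of the line. [cite: Balaban1985Variational, (3)-(6) p.278] -/
theorem symCentre_gaugeAct (h : n ≤ K) (u : GaugeTransf (F.P K) 0 (Matrix.specialUnitaryGroup (Fin 2) ℂ))
    {V : GaugeField (F.P n) 0 (Matrix.specialUnitaryGroup (Fin 2) ℂ)} {U₀ : GaugeField (F.P K) 0 (Matrix.specialUnitaryGroup (Fin 2) ℂ)}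
    {a b : ℝ} (ha : 0 ≤ a) (hb : 0 < b) (hfib : U₀ ∈ fibre F ℰp n K h V) (hreg : RegPr F n K a U₀)
    (hLift : ∀ cf : Site (F.P K) (K - n) → Matrix (Fin 2) (Fin 2) ℂ,
      (∀ e : PBond (F.P K) (K - n), cf e.src = ((emlIterU (K - n) (bgUnits F K U₀) e : (Matrix (Fin 2) (Fin 2) ℂ)ˣ) : Matrix (Fin 2) (Fin 2) ℂ) * cf e.tgt *
        (((emlIterU (K - n) (bgUnits F K U₀) e)⁻¹ : (Matrix (Fin 2) (Fin 2) ℂ)ˣ) : Matrix (Fin 2) (Fin 2) ℂ)) →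
      ∃ l₀ : Site (F.P K) 0 → Matrix (Fin 2) (Fin 2) ℂ,
        (∀ b' : PBond (F.P K) 0, l₀ b'.src = ((bgUnits F K U₀ b' : (Matrix (Fin 2) (Fin 2) ℂ)ˣ) : Matrix (Fin 2) (Fin 2) ℂ) * l₀ b'.tgt * (((bgUnits F K U₀ b')⁻¹ : (Matrix (Fin 2) (Fin 2) ℂ)ˣ) : Matrix (Fin 2) (Fin 2) ℂ)) ∧
        ∀ y : Site (F.P K) (K - n), l₀ (embIter (K - n) y) = cf y) :
    GaugeField.gaugeAct u U₀ ∈ fibre F ℰp n K h (GaugeField.gaugeAct (descTransf F n K h u) V) ∧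
      RegPr F n K a (GaugeField.gaugeAct u U₀) ∧
      CloseAvg F n K h b (GaugeField.gaugeAct (descTransf F n K h u) V) (GaugeField.gaugeAct u U₀) ∧
      ∀ cf : Site (F.P K) (K - n) → Matrix (Fin 2) (Fin 2) ℂ,
        (∀ e : PBond (F.P K) (K - n), cf e.src = ((emlIterU (K - n) (bgUnits F K (GaugeField.gaugeAct u U₀)) e : (Matrix (Fin 2) (Fin 2) ℂ)ˣ) : Matrix (Fin 2) (Fin 2) ℂ) * cf e.tgt *
          (((emlIterU (K - n) (bgUnits F K (GaugeField.gaugeAct u U₀)) e)⁻¹ : (Matrix (Fin 2) (Fin 2) ℂ)ˣ) : Matrix (Fin 2) (Fin 2) ℂ)) →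
        ∃ l₀ : Site (F.P K) 0 → Matrix (Fin 2) (Fin 2) ℂ,
          (∀ b' : PBond (F.P K) 0, l₀ b'.src = ((bgUnits F K (GaugeField.gaugeAct u U₀) b' : (Matrix (Fin 2) (Fin 2) ℂ)ˣ) : Matrix (Fin 2) (Fin 2) ℂ) * l₀ b'.tgt *
            (((bgUnits F K (GaugeField.gaugeAct u U₀) b')⁻¹ : (Matrix (Fin 2) (Fin 2) ℂ)ˣ) : Matrix (Fin 2) (Fin 2) ℂ)) ∧
          ∀ y : Site (F.P K) (K - n), l₀ (embIter (K - n) y) = cf y := by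
  have hfib' : GaugeField.gaugeAct u U₀ ∈ fibre F ℰp n K h (GaugeField.gaugeAct (descTransf F n K h u) V) :=
    (gaugeAct_mem_fibre_iff F h ℰp u U₀ V).2 hfib
  exact ⟨hfib', (regPr_gaugeAct_iff F ha u U₀).2 hreg, closeAvg_of_mem_fibre hb hfib', hLift_gaugeAct F u U₀ hLift⟩

/-! ## §4 Over an irreducible coarse field every regular fibre point is a symmetric centre -/

/-- ★★ **`hLift` AT EVERY REGULAR FIBRE POINT OVER AN IRREDUCIBLE `V`.**  If the only `V♭`-parallel sections of the comparison lattice are the scalars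
`z • 1` («`V` has irreducible holonomy» — the generic coarse field), then for every `U₀ ∈ fibre V` printed-regular with `10⁷L³ε₀ ≤ 1` the residue `hLift U₀`
holds: on `𝔘_k(ε₀)` the descent IS the unguarded iterated average (`V♭ = fieldShift (Ū₀♭⁽ᴷ⁻ⁿ⁾)`, ✓`descendTo_eq_fieldShift_emlIterU_of_regPr`), so a
`Ū₀`-parallel coarse section read through `siteShift` is `V♭`-parallel, hence scalar, and scalars lift (✓`hLift_of_onlyScalarParallel`).
[cite: Balaban1985BackgroundPropagators, (3.21) p.394; Balaban1985Variational, (3) p.278, (6) p.278; Balaban1987RG1, (0.4) p.253] -/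
theorem hLift_of_mem_fibre_of_irreducible (h : n ≤ K) {ε₀ : ℝ} (hε₀ : 0 < ε₀) (hε : 10 ^ 7 * (F.L : ℝ) ^ 3 * ε₀ ≤ 1)
    {V : GaugeField (F.P n) 0 (Matrix.specialUnitaryGroup (Fin 2) ℂ)} {U₀ : GaugeField (F.P K) 0 (Matrix.specialUnitaryGroup (Fin 2) ℂ)}
    (hfib : U₀ ∈ fibre F ℰp n K h V) (hreg : RegPr F n K ε₀ U₀)
    (hIrr : ∀ c : Site (F.P n) 0 → Matrix (Fin 2) (Fin 2) ℂ,
      (∀ b' : PBond (F.P n) 0, c b'.src = ((bgUnits F n V b' : (Matrix (Fin 2) (Fin 2) ℂ)ˣ) : Matrix (Fin 2) (Fin 2) ℂ) * c b'.tgt *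
        (((bgUnits F n V b')⁻¹ : (Matrix (Fin 2) (Fin 2) ℂ)ˣ) : Matrix (Fin 2) (Fin 2) ℂ)) →
      ∃ z : ℂ, ∀ y, c y = z • (1 : Matrix (Fin 2) (Fin 2) ℂ)) :
    ∀ cf : Site (F.P K) (K - n) → Matrix (Fin 2) (Fin 2) ℂ,
      (∀ e : PBond (F.P K) (K - n), cf e.src = ((emlIterU (K - n) (bgUnits F K U₀) e : (Matrix (Fin 2) (Fin 2) ℂ)ˣ) : Matrix (Fin 2) (Fin 2) ℂ) * cf e.tgt *
        (((emlIterU (K - n) (bgUnits F K U₀) e)⁻¹ : (Matrix (Fin 2) (Fin 2) ℂ)ˣ) : Matrix (Fin 2) (Fin 2) ℂ)) →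
      ∃ l₀ : Site (F.P K) 0 → Matrix (Fin 2) (Fin 2) ℂ,
        (∀ b' : PBond (F.P K) 0, l₀ b'.src = ((bgUnits F K U₀ b' : (Matrix (Fin 2) (Fin 2) ℂ)ˣ) : Matrix (Fin 2) (Fin 2) ℂ) * l₀ b'.tgt * (((bgUnits F K U₀ b')⁻¹ : (Matrix (Fin 2) (Fin 2) ℂ)ˣ) : Matrix (Fin 2) (Fin 2) ℂ)) ∧
        ∀ y : Site (F.P K) (K - n), l₀ (embIter (K - n) y) = cf y := by
  -- on `𝔘_k(ε₀)` the descent is the unguarded iterated average, read through the level identification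
  have hV : (descendTo F ℰp n K h U₀ : GaugeField (F.P n) 0 (Matrix.specialUnitaryGroup (Fin 2) ℂ)) = V := hfib
  have key := descendTo_eq_fieldShift_emlIterU_of_regPr F h hε₀ hε hreg
  rw [hV] at key
  -- `bgUnits F n V = V♭ = fieldShift hs (Ū₀♭)` in the `bgUnits` letter, with the level identification `hs` packaged
  obtain ⟨hs, key'⟩ : ∃ hs : (F.PP F.m n).sitesPerDir 0 = (F.PP F.m K).sitesPerDir (K - n),
      bgUnits F n V = fieldShift hs (emlIterU (K - n) (bgUnits F K U₀)) := ⟨_, key⟩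
  refine hLift_of_onlyScalarParallel F U₀ fun cf hpar => ?_
  -- the coarse section read on the comparison lattice is `V♭`-parallel
  obtain ⟨z, hz⟩ := hIrr (fun y => cf (siteShift hs y)) fun b' => by
    have hp := hpar (bondShift hs b')
    -- the bond identification commutes with `src`∕`tgt` (stated at the `F.P` letters of `hpar`, so that `rw` matches syntactically)
    have hsrc : @PBond.src (F.P K) (K - n) (bondShift hs b') = siteShift hs b'.src := bondShift_src hs b'
    have htgt : @PBond.tgt (F.P K) (K - n) (bondShift hs b') = siteShift hs b'.tgt := bondShift_tgt hs b'
    rw [hsrc, htgt] at hp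
    show cf (siteShift hs b'.src) = _ * cf (siteShift hs b'.tgt) * _
    rw [hp, key', fieldShift_apply]
    rfl
  refine ⟨z, fun x => ?_⟩
  have hx := hz ((siteShift hs).symm x)
  simpa only [Equiv.apply_symm_apply] using hx

/-- **`hSymCentre` OVER AN IRREDUCIBLE `V` FROM ANY REGULAR FIBRE POINT** (the stub's own antecedents `U₀ ∈ fibre V`, `RegPr a U₀` suffice; `10⁷L³a ≤ 1`, `b > 0`).
[cite: Balaban1985Variational, (3) p.278, (6) p.278, (13)-(14) p.280] -/
theorem hSymCentre_of_irreducible (h : n ≤ K) {a b : ℝ} (ha : 0 < a) (haW : 10 ^ 7 * (F.L : ℝ) ^ 3 * a ≤ 1) (hb : 0 < b)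
    {V : GaugeField (F.P n) 0 (Matrix.specialUnitaryGroup (Fin 2) ℂ)} {U₀ : GaugeField (F.P K) 0 (Matrix.specialUnitaryGroup (Fin 2) ℂ)}
    (hfib : U₀ ∈ fibre F ℰp n K h V) (hreg : RegPr F n K a U₀)
    (hIrr : ∀ c : Site (F.P n) 0 → Matrix (Fin 2) (Fin 2) ℂ,
      (∀ b' : PBond (F.P n) 0, c b'.src = ((bgUnits F n V b' : (Matrix (Fin 2) (Fin 2) ℂ)ˣ) : Matrix (Fin 2) (Fin 2) ℂ) * c b'.tgt *
        (((bgUnits F n V b')⁻¹ : (Matrix (Fin 2) (Fin 2) ℂ)ˣ) : Matrix (Fin 2) (Fin 2) ℂ)) →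
      ∃ z : ℂ, ∀ y, c y = z • (1 : Matrix (Fin 2) (Fin 2) ℂ)) :
    ∃ U₀' : GaugeField (F.P K) 0 (Matrix.specialUnitaryGroup (Fin 2) ℂ),
      U₀' ∈ fibre F ℰp n K h V ∧ RegPr F n K a U₀' ∧ CloseAvg F n K h b V U₀' ∧
      ∀ cf : Site (F.P K) (K - n) → Matrix (Fin 2) (Fin 2) ℂ,
        (∀ e : PBond (F.P K) (K - n), cf e.src = ((emlIterU (K - n) (bgUnits F K U₀') e : (Matrix (Fin 2) (Fin 2) ℂ)ˣ) : Matrix (Fin 2) (Fin 2) ℂ) * cf e.tgt *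
          (((emlIterU (K - n) (bgUnits F K U₀') e)⁻¹ : (Matrix (Fin 2) (Fin 2) ℂ)ˣ) : Matrix (Fin 2) (Fin 2) ℂ)) →
        ∃ l₀ : Site (F.P K) 0 → Matrix (Fin 2) (Fin 2) ℂ,
          (∀ b' : PBond (F.P K) 0, l₀ b'.src = ((bgUnits F K U₀' b' : (Matrix (Fin 2) (Fin 2) ℂ)ˣ) : Matrix (Fin 2) (Fin 2) ℂ) * l₀ b'.tgt * (((bgUnits F K U₀' b')⁻¹ : (Matrix (Fin 2) (Fin 2) ℂ)ˣ) : Matrix (Fin 2) (Fin 2) ℂ)) ∧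
          ∀ y : Site (F.P K) (K - n), l₀ (embIter (K - n) y) = cf y :=
  ⟨U₀, hfib, hreg, closeAvg_of_mem_fibre hb hfib, hLift_of_mem_fibre_of_irreducible F h ha haW hfib hreg hIrr⟩

end T3

end Summit.QuantumFields.YangMills.Theorems.Prop7NestedMeanParallelLift

end
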